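import Mathlib.RingTheory.Flat.Basic
import Mathlib.RingTheory.Artinian.Module
import Mathlib.RingTheory.HopkinsLevitzki
import Mathlib.RingTheory.SimpleModule.Basic
import Mathlib.RingTheory.LocalRing.ResidueField.Basic
import Mathlib.LinearAlgebra.TensorProduct.RightExactness
import HarnessLib

/-!
# Dévissage for the kernel of a map of flat modules over an Artin local ring
# («cohomological flatness in dimension 0»: Görtz–Wedhorn II, Exercise 23.43, Cor. 24.63; EGA III 7.7–7.8; Mumford §5)

Topic `Algebra/Module`; namespace `Literature.Algebra.Module`; a *proofs* file (theorems only, Mathlib only). The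
linear algebra behind «`Γ(X_T, 𝒪) = Γ(T, 𝒪)` for an Artin local `T`» (cell `hodgecm-mathlib`, (U)-lane brick (u7)
«universal Stein for abelian schemes», piece (u7-ii); consumer ★ `AbelianSchemes/AbelianSchemeSteinOfArtinian`).

SETTING. `R` a commutative ring, `δ : P →ₗ[R] Q` a linear map between FLAT `R`-modules and `u ∈ ker δ` (in the
application: `P = Π Γ(X, Wᵢ)`, `Q = Π Γ(X, Wᵢ ∩ Wⱼ)` for a finite affine cover of a flat `R`-scheme `X`, `δ` the Čech
differential, `u = (1)ᵢ`; then `ker(δ ⊗ M) = Γ(X, 𝒪_X ⊗ M)`). For an `R`-module `M` the map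
`θ_M : M → M ⊗[R] P, m ↦ m ⊗ u` lands in `ker(δ ⊗ M)` (`lTensor_tmul_eq_zero`); we say **`M` is `u`-generated** when
every element of `ker(δ ⊗ M)` is `m ⊗ u` for a UNIQUE `m` — spelled out, no definition:
`∀ x : M ⊗[R] P, δ.lTensor M x = 0 → ∃! m, m ⊗ₜ u = x`.

* §1 `existsUnique_tmul_of_linearEquiv` — transport along `M ≃ₗ[R] N`; `existsUnique_tmul_of_subsingleton`.
* §2 **`existsUnique_tmul_of_exact`** — for `0 → M′ → M → M″ → 0` exact, if `M′` and `M″` are `u`-generated so is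
  `M` (flatness of `P` and `Q` makes `M ↦ ker(δ ⊗ M)` left exact; four-lemma).
* §3 **`existsUnique_tmul_of_isArtinianRing`** — over an ARTIN LOCAL ring: if the residue field `k = R ⧸ 𝔪` is
  `u`-generated then every finite `R`-module is (composition series: every simple factor is `≅ k`); in particular
  `R` itself: **`existsUnique_smul_eq_of_isArtinianRing`** — `ker δ = R·u ≅ R`.

No `H¹`, no length counts: this is the dévissage behind «cohomologically flat in dimension 0» (Görtz–Wedhorn II,
Exercise 23.43 / Cor. 24.63; EGA III 7.7–7.8; Mumford, *Abelian Varieties*, §5) over an Artinian base, isolated as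
Mathlib-only algebra. Mathlib searched and used (pin):
`Module.Flat.rTensor_preserves_injective_linearMap`, `rTensor_exact`, `LinearMap.rTensor_surjective`,
`isSimpleModule_iff_quot_maximal`, `isSimpleModule_iff_isCoatom`, `IsArtinian.induction`, `IsCoatomic` of the
submodule lattice of a finite module, Hopkins–Levitzki (`IsArtinianRing → IsNoetherianRing`); Mathlib has no
cohomology-and-base-change statements.

## References

* U. Görtz, T. Wedhorn, *Algebraic Geometry II: Cohomology of Schemes* (2023), Exercise 23.43 (p. 374),
  Cor. 24.63 (p. 404). [GortzWedhorn2023]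
* A. Grothendieck, EGA III₂ (Publ. Math. IHÉS 17, 1963), §7.7–7.8 (changement de base, platitude cohomologique). [EGAIII2]
* D. Mumford, *Abelian Varieties*, TIFR Studies in Mathematics 5 (2nd ed. 1974), §5 (pp. 46–51). [MumfordAV1970]
-/

universe u

open TensorProduct

noncomputable section

namespace Literature.Algebra.Module

variable {R : Type u} [CommRing R] {P Q : Type u} [AddCommGroup P] [Module R P] [AddCommGroup Q] [Module R Q]
  (δ : P →ₗ[R] Q) (u : P)

/-! ### §1 `θ_M : m ↦ m ⊗ u` lands in `ker(δ ⊗ M)`; transport along isomorphisms -/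

section General

variable {M N : Type u} [AddCommGroup M] [Module R M] [AddCommGroup N] [Module R N]

/-- `(δ ⊗ M)(m ⊗ u) = m ⊗ δ u = 0` for `u ∈ ker δ`. [folklore] [cite: GortzWedhorn2023, Exercise 23.43 (p. 374)] -/
theorem lTensor_tmul_eq_zero (hu : δ u = 0) (m : M) : δ.lTensor M (m ⊗ₜ[R] u) = 0 := by
  rw [LinearMap.lTensor_tmul, hu, tmul_zero]

/-- Naturality of `θ`: `(g ⊗ P)(m ⊗ u) = g m ⊗ u`. [folklore] [cite: GortzWedhorn2023, Exercise 23.43 (p. 374)] -/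
theorem rTensor_tmul_generator (g : M →ₗ[R] N) (m : M) : g.rTensor P (m ⊗ₜ[R] u) = g m ⊗ₜ[R] u :=
  LinearMap.rTensor_tmul _ _ _ _

/-- Naturality of `δ ⊗ −`: `(δ ⊗ N) ∘ (g ⊗ P) = (g ⊗ Q) ∘ (δ ⊗ M)`. [folklore] [cite: GortzWedhorn2023, Exercise 23.43 (p. 374)] -/
theorem lTensor_rTensor_comm (g : M →ₗ[R] N) (x : M ⊗[R] P) :
    δ.lTensor N (g.rTensor P x) = g.rTensor Q (δ.lTensor M x) := by
  rw [← LinearMap.comp_apply, ← LinearMap.comp_apply, LinearMap.lTensor_comp_rTensor,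
    LinearMap.rTensor_comp_lTensor]

/-- From `u`-generation: `θ_M` is injective. [folklore] [cite: GortzWedhorn2023, Exercise 23.43 (p. 374)] -/
theorem tmul_generator_injective (hu : δ u = 0)
    (h : ∀ x : M ⊗[R] P, δ.lTensor M x = 0 → ∃! m : M, m ⊗ₜ[R] u = x) :
    Function.Injective fun m : M => m ⊗ₜ[R] u := by
  intro m m' hmm'
  obtain ⟨m₀, -, huniq⟩ := h (m ⊗ₜ[R] u) (lTensor_tmul_eq_zero δ u hu m)
  exact (huniq m rfl).trans (huniq m' hmm'.symm).symm

/-- **Transport of `u`-generation along a linear isomorphism `M ≃ N`.** [folklore] [cite: GortzWedhorn2023, Exercise 23.43 (p. 374)] -/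
theorem existsUnique_tmul_of_linearEquiv (e : M ≃ₗ[R] N)
    (h : ∀ x : M ⊗[R] P, δ.lTensor M x = 0 → ∃! m : M, m ⊗ₜ[R] u = x) :
    ∀ x : N ⊗[R] P, δ.lTensor N x = 0 → ∃! n : N, n ⊗ₜ[R] u = x := by
  intro x hx
  -- pull `x` back to `M ⊗ P`
  have hy : δ.lTensor M ((e.symm : N →ₗ[R] M).rTensor P x) = 0 := by
    rw [lTensor_rTensor_comm, hx, map_zero]
  obtain ⟨m, hm, huniq⟩ := h _ hy
  refine ⟨e m, ?_, fun n hn => ?_⟩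
  · have := congrArg ((e : M →ₗ[R] N).rTensor P) hm
    rw [rTensor_tmul_generator, ← LinearMap.comp_apply, ← LinearMap.rTensor_comp] at this
    simpa using this
  · have hn' : e.symm n ⊗ₜ[R] u = (e.symm : N →ₗ[R] M).rTensor P x := by
      rw [← hn, rTensor_tmul_generator]; rfl
    rw [← huniq _ hn', LinearEquiv.apply_symm_apply]

/-- The zero module is `u`-generated. [folklore] [cite: GortzWedhorn2023, Exercise 23.43 (p. 374)] -/
theorem existsUnique_tmul_of_subsingleton [Subsingleton M] :
    ∀ x : M ⊗[R] P, δ.lTensor M x = 0 → ∃! m : M, m ⊗ₜ[R] u = x := by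
  intro x _
  refine ⟨0, ?_, fun m _ => Subsingleton.elim _ _⟩
  induction x using TensorProduct.induction_on with
  | zero => rw [zero_tmul]
  | tmul m p => rw [Subsingleton.elim m 0, zero_tmul, zero_tmul]
  | add y z hy hz => rw [Subsingleton.elim y 0, Subsingleton.elim z 0, add_zero, zero_tmul]

end General

/-! ### §2 Four-lemma: `u`-generation is closed under extensions (flatness of `P`, `Q`) -/

section Exact

variable [Module.Flat R P] [Module.Flat R Q]
variable {M' M M'' : Type u} [AddCommGroup M'] [Module R M'] [AddCommGroup M] [Module R M]
  [AddCommGroup M''] [Module R M'']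

/-- **Extensions.** For `0 → M′ —ι→ M —π→ M″ → 0` exact: if every element of `ker(δ ⊗ M′)` resp. `ker(δ ⊗ M″)` is
`m ⊗ u` for a unique `m`, the same holds for `M`. Uses: `ι ⊗ P`, `ι ⊗ Q` injective (FLATNESS of `P`, `Q`),
`M′ ⊗ P → M ⊗ P → M″ ⊗ P` exact and `π ⊗ P` onto (right exactness) — i.e. `M ↦ ker(δ ⊗ M)` is left exact —
and a four-lemma chase. [cite: GortzWedhorn2023, Exercise 23.43 (p. 374)] [cite: GortzWedhorn2023, Cor. 24.63 (p. 404), step] -/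
theorem existsUnique_tmul_of_exact (hu : δ u = 0) (ι : M' →ₗ[R] M) (π : M →ₗ[R] M'')
    (hι : Function.Injective ι) (hex : Function.Exact ι π) (hπ : Function.Surjective π)
    (h' : ∀ x : M' ⊗[R] P, δ.lTensor M' x = 0 → ∃! m : M', m ⊗ₜ[R] u = x)
    (h'' : ∀ x : M'' ⊗[R] P, δ.lTensor M'' x = 0 → ∃! m : M'', m ⊗ₜ[R] u = x) :
    ∀ x : M ⊗[R] P, δ.lTensor M x = 0 → ∃! m : M, m ⊗ₜ[R] u = x := by
  have hιP : Function.Injective (ι.rTensor P) := Module.Flat.rTensor_preserves_injective_linearMap ι hι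
  have hιQ : Function.Injective (ι.rTensor Q) := Module.Flat.rTensor_preserves_injective_linearMap ι hι
  have hexP : Function.Exact (ι.rTensor P) (π.rTensor P) := rTensor_exact P hex hπ
  have hinj' := tmul_generator_injective δ u hu h'
  have hinj'' := tmul_generator_injective δ u hu h''
  intro x hx
  -- existence
  have hx'' : δ.lTensor M'' (π.rTensor P x) = 0 := by rw [lTensor_rTensor_comm, hx, map_zero]
  obtain ⟨m'', hm'', -⟩ := h'' _ hx''
  obtain ⟨m, rfl⟩ := hπ m''
  -- `x - m ⊗ u` dies in `M″ ⊗ P`, so comes from `M′ ⊗ P`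
  have hdiff : π.rTensor P (x - m ⊗ₜ[R] u) = 0 := by
    rw [map_sub, rTensor_tmul_generator, hm'', sub_self]
  obtain ⟨y, hy⟩ := (hexP _).1 hdiff
  have hy0 : δ.lTensor M' y = 0 := by
    apply hιQ
    rw [← lTensor_rTensor_comm, hy, map_sub, hx, lTensor_tmul_eq_zero δ u hu, sub_zero, map_zero]
  obtain ⟨m', hm', -⟩ := h' y hy0
  refine ⟨m + ι m', ?_, ?_⟩
  · change (m + ι m') ⊗ₜ[R] u = x
    rw [add_tmul, ← rTensor_tmul_generator u ι, hm', hy, add_sub_cancel]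
  -- uniqueness (= injectivity of `θ_M`)
  · intro n hn
    have hπn : π n = π (m + ι m') := by
      apply hinj''
      change π n ⊗ₜ[R] u = π (m + ι m') ⊗ₜ[R] u
      rw [← rTensor_tmul_generator u π, ← rTensor_tmul_generator u π, hn, add_tmul,
        ← rTensor_tmul_generator u ι m', hm', hy, add_sub_cancel]
    obtain ⟨m₁, hm₁⟩ := (hex _).1 (show π (n - (m + ι m')) = 0 by rw [map_sub, hπn, sub_self])
    have hm₁0 : m₁ ⊗ₜ[R] u = 0 := by
      apply hιP
      rw [rTensor_tmul_generator, hm₁, sub_tmul, hn, add_tmul, ← rTensor_tmul_generator u ι m', hm', hy,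
        add_sub_cancel, sub_self, map_zero]
    have : m₁ = 0 := hinj' (by change m₁ ⊗ₜ[R] u = (0 : M') ⊗ₜ[R] u; rw [hm₁0, zero_tmul])
    rw [this, map_zero, eq_comm, sub_eq_zero] at hm₁
    exact hm₁

end Exact

/-! ### §3 Artin local rings: dévissage along a composition series -/

section Artinian

variable [Module.Flat R P] [Module.Flat R Q] [IsLocalRing R]

/-- A simple module over a local ring is isomorphic to the residue field. [folklore]
[cite: GortzWedhorn2023, Exercise 23.43 (p. 374)] -/
theorem nonempty_linearEquiv_residueField_of_isSimpleModule (M : Type u) [AddCommGroup M] [Module R M]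
    [IsSimpleModule R M] : Nonempty (M ≃ₗ[R] IsLocalRing.ResidueField R) := by
  obtain ⟨I, hI, ⟨e⟩⟩ := isSimpleModule_iff_quot_maximal.1 ‹IsSimpleModule R M›
  have hI' : I = IsLocalRing.maximalIdeal R := IsLocalRing.eq_maximalIdeal hI
  subst hI'
  exact ⟨e⟩

/-- **Dévissage over an Artin local ring.** If the residue field `k` is `u`-generated (every element of
`ker(δ ⊗ k)` is `c ⊗ u` for a unique `c ∈ k`), then so is every finite `R`-module `M`: induction over the (Artinian)
submodule lattice — a non-zero finite `N` has a maximal submodule `N′` with `N ⧸ N′ ≅ k`, and §2 applies to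
`0 → N′ → N → k → 0`. [cite: GortzWedhorn2023, Exercise 23.43 (p. 374)] [cite: GortzWedhorn2023, Cor. 24.63 (p. 404), step] -/
theorem existsUnique_tmul_of_isArtinianRing [IsArtinianRing R] (hu : δ u = 0)
    (hk : ∀ x : IsLocalRing.ResidueField R ⊗[R] P, δ.lTensor (IsLocalRing.ResidueField R) x = 0 →
      ∃! c : IsLocalRing.ResidueField R, c ⊗ₜ[R] u = x)
    (M : Type u) [AddCommGroup M] [Module R M] [Module.Finite R M] :
    ∀ x : M ⊗[R] P, δ.lTensor M x = 0 → ∃! m : M, m ⊗ₜ[R] u = x := by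
  -- the predicate on submodules `N ⊆ M`: `↥N` is `u`-generated
  suffices hall : ∀ N : Submodule R M,
      ∀ x : N ⊗[R] P, δ.lTensor N x = 0 → ∃! m : N, m ⊗ₜ[R] u = x from
    existsUnique_tmul_of_linearEquiv δ u Submodule.topEquiv (hall ⊤)
  intro N
  induction N using IsArtinian.induction with
  | hgt N ih =>
    by_cases hN : N = ⊥
    · subst hN
      exact existsUnique_tmul_of_subsingleton δ u
    -- a maximal submodule `J₀ ⊊ N` (the lattice of submodules of the finite module `↥N` is coatomic)
    · haveI : IsNoetherian R M := isNoetherian_of_isNoetherianRing_of_finite R M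
      haveI : Nontrivial (Submodule R N) := by
        rw [Submodule.nontrivial_iff]
        exact Submodule.nontrivial_iff_ne_bot.2 hN
      obtain ⟨J₀, hJ₀⟩ := IsCoatomic.exists_coatom (α := Submodule R N)
      haveI : IsSimpleModule R (N ⧸ J₀) := isSimpleModule_iff_isCoatom.2 hJ₀
      obtain ⟨ek⟩ := nonempty_linearEquiv_residueField_of_isSimpleModule (R := R) (N ⧸ J₀)
      -- `J₀` seen inside `M` is strictly below `N`
      have hlt : J₀.map N.subtype < N := by
        refine lt_of_le_of_ne (Submodule.map_subtype_le N J₀) fun heq => hJ₀.1 ?_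
        apply Submodule.map_injective_of_injective N.injective_subtype
        rw [heq, Submodule.map_subtype_top]
      have hJ : ∀ x : J₀ ⊗[R] P, δ.lTensor J₀ x = 0 → ∃! m : J₀, m ⊗ₜ[R] u = x :=
        existsUnique_tmul_of_linearEquiv δ u (Submodule.equivMapOfInjective _ N.injective_subtype J₀).symm
          (ih _ hlt)
      have hq : ∀ x : (N ⧸ J₀) ⊗[R] P, δ.lTensor (N ⧸ J₀) x = 0 → ∃! m : N ⧸ J₀, m ⊗ₜ[R] u = x :=
        existsUnique_tmul_of_linearEquiv δ u ek.symm hk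
      exact existsUnique_tmul_of_exact δ u hu J₀.subtype J₀.mkQ J₀.injective_subtype
        (LinearMap.exact_subtype_mkQ J₀) (Submodule.mkQ_surjective J₀) hJ hq

/-- **`ker δ = R·u ≅ R` over an Artin local ring**: if the residue field is `u`-generated then every `x ∈ ker δ`
is `r • u` for a unique `r ∈ R` (the case `M = R` of `existsUnique_tmul_of_isArtinianRing`, read through
`R ⊗[R] P ≅ P`). [cite: GortzWedhorn2023, Exercise 23.43 (p. 374)] [cite: GortzWedhorn2023, Cor. 24.63 (p. 404), step] -/
theorem existsUnique_smul_eq_of_isArtinianRing [IsArtinianRing R] (hu : δ u = 0)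
    (hk : ∀ x : IsLocalRing.ResidueField R ⊗[R] P, δ.lTensor (IsLocalRing.ResidueField R) x = 0 →
      ∃! c : IsLocalRing.ResidueField R, c ⊗ₜ[R] u = x)
    (x : P) (hx : δ x = 0) : ∃! r : R, r • u = x := by
  have h := existsUnique_tmul_of_isArtinianRing δ u hu hk R ((1 : R) ⊗ₜ[R] x)
    (by rw [LinearMap.lTensor_tmul, hx, tmul_zero])
  obtain ⟨r, hr, huniq⟩ := h
  refine ⟨r, ?_, fun s hs => huniq s ?_⟩
  · have := congrArg (TensorProduct.lid R P) hr
    rwa [TensorProduct.lid_tmul, TensorProduct.lid_tmul, one_smul] at this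
  · apply (TensorProduct.lid R P).injective
    rw [TensorProduct.lid_tmul, TensorProduct.lid_tmul, one_smul, hs]

end Artinian

end Literature.Algebra.Module

end
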